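import Summits.RiemannHypothesis.RiemannHypothesis.Theorems.PfPersistenceCoefficientRigiditySummablePrelim
import Summits.RiemannHypothesis.RiemannHypothesis.Theorems.PfPersistenceCoefficientRigidityUniformTrig
import Mathlib.Analysis.Normed.Group.InfiniteSum
import HarnessLib

/-!
# Coefficient rigidity of window positivity, V-b: `ζ`'s weight table is `ℓ¹`-isolated in the
positive cone (pub-rhpf cand-7, gen 9; mechanism/rigidity campaign; no RH claims)

Fifth part of `PfPersistenceCoefficientRigidity`.  Part IV-b handled finitely many perturbed
entries; here the perturbation may touch infinitely many entries, provided it is absolutely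
summable.  ALL STATEMENTS ARE PROVED (no `sorry`, no new axioms, RH only inside a `by_cases`);
no sentence of this file is DATA.

* `not_positivity_of_summable_edit` — **MAIN THEOREM (RH-free)**: if a real weight table `w`
  satisfies `∑_n |Λ(n)/√n - w(n)| < ∞`, agrees with `ζ`'s table at `n = 0, 1` (no mass at the
  exceptional site `x = 0`) and differs from it somewhere, then `tableDatum w` violates
  `ExplicitDatum.Positivity`.
* `tableDatum_positivity_iff_of_summable` — for such `w`:
  `Positivity (tableDatum w) ↔ (w = ζ's table ∧ RiemannHypothesis)`.  Within its whole
  `ℓ¹`-neighbourhood (on the sites `log n`, `n ≥ 2`) `ζ`'s explicit-formula datum is the ONLY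
  candidate for positivity; whether it is positive is RH (Weil's criterion, imported) and is NOT
  claimed.

Mechanism.  `¬RH`: the site terms are bounded by `2‖c‖₁‖g‖₂²`, part I's sinking ground energy wins.
RH: wave packets `g_{R,t₀}` (part III-a).  The new point is UNIFORMITY: part V-a gives a carrier
range `[0, T₀]` and a negative value `-δ₁` of the finite cosine sums `P_N(t) = ∑_{2≤n≤N} c_n cos(t log n)`
depending only on `‖c‖₁`, the resonant coefficient and `log 2`, `log(1 + 1/n₁)`; an `ℓ¹` tail cut
makes `P_N(t₀) ≤ -δ₁/2` for ALL large `N` at one carrier `t₀` off the ordinates (part III-a); a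
second tail cut bounds the far-site overlap errors by `4R·tail`, the near-site ones by the
Lipschitz estimate of part IV-b.  Total `≤ M S + 4KA₁ - (3/4)δ₁R < 0` for large `R`
(`M S`: the zero side at the fixed carrier, `A₁ = ∑_{n ≤ N₁} |c_n| log n`).

References: E. Bombieri, Rend. Lincei (9) 11 (2000) 183–233, §3; A. Weil (1952); H. Bohr (1925).
-/

set_option linter.dupNamespace false

noncomputable section

open Complex Filter Set MeasureTheory
open scoped Real Topology ComplexConjugate NNReal

namespace Summit.RiemannHypothesis.RiemannHypothesis.Theorems.PfPersistenceCoefficientRigidity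

open Literature.NumberTheory.LFunctions
open Literature.NumberTheory.LFunctions.WeilConverse
open Summit.RiemannHypothesis.RiemannHypothesis.Theorems.PfPersistenceDownCone
open Summit.RiemannHypothesis.RiemannHypothesis.Theorems.PfPersistenceBarrier

/-! ## §28 The RH branch: one carrier for all truncations -/

/-- **RH branch, summable coefficients.**  Under RH, for `c : ℕ → ℝ` with `∑ |c_n| < ∞` and some
`c_{n₁} ≠ 0`, `n₁ ≥ 2`, there are `R > 0`, a carrier `t₀` and a cut-off `N ≥ 2` with
`R ≤ log(N+1)/2` such that the wave packet `g_{R,t₀}` makes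
`Re (W(g ⋆ g̃) + ∑_{2 ≤ n ≤ N} c_n ((g ⋆ g̃)(log n) + (g ⋆ g̃)(-log n))) < 0`. [this work] -/
theorem exists_wavePacket_multiSite_neg_of_summable (hRH : RiemannHypothesis) {c : ℕ → ℝ}
    (hsum : Summable fun n ↦ |c n|) {n₁ : ℕ} (hn₁ : 2 ≤ n₁) (hc₁ : c n₁ ≠ 0) :
    ∃ R t₀ : ℝ, ∃ N : ℕ, 0 < R ∧ 2 ≤ N ∧ R ≤ Real.log ((N : ℝ) + 1) / 2 ∧
      (multiSiteQuadratic (Finset.Ico 2 (N + 1)) c (fun n : ℕ ↦ Real.log (n : ℝ))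
        (wavePacket R t₀)).re < 0 := by
  -- uniform constants
  set L := ∑' n, |c n| with hLdef
  have hL0 : 0 ≤ L := tsum_nonneg fun n ↦ abs_nonneg _
  have hLE : ∀ E : Finset ℕ, ∑ n ∈ E, |c n| ≤ L := fun E ↦
    hsum.sum_le_tsum E fun n _ ↦ abs_nonneg _
  set m := Real.log 2 with hmdef
  have hm0 : 0 < m := Real.log_pos one_lt_two
  have hn₁0 : (0 : ℝ) < n₁ := by exact_mod_cast (by omega : 0 < n₁)
  set γ := Real.log ((n₁ : ℝ) + 1) - Real.log n₁ with hγdef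
  have hγ0 : 0 < γ := sub_pos.2 (Real.log_lt_log hn₁0 (by linarith))
  set C₀ := 1 / m + 1 / (4 * m) + (1 / γ + 1 / m) / 2 with hC₀
  have hC₀0 : 0 < C₀ := by positivity
  have hα : 0 < |c n₁| := abs_pos.2 hc₁
  set δ₁ := |c n₁| / (4 * (C₀ * L + 2)) with hδ₁
  have hδ₁0 : 0 < δ₁ := by positivity
  have hmem : ∀ {N n : ℕ}, n ∈ Finset.Ico 2 (N + 1) → 2 ≤ n := fun h ↦ (Finset.mem_Ico.1 h).1
  have hxm : ∀ n : ℕ, 2 ≤ n → m ≤ Real.log (n : ℝ) := fun n hn ↦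
    Real.log_le_log two_pos (by exact_mod_cast hn)
  -- tails
  have htail : ∀ {ε : ℝ} {s : Finset ℕ}, (∀ t : Finset ℕ, Disjoint t s → ‖∑ n ∈ t, |c n|‖ < ε) →
      ∀ N' N : ℕ, s.sup id ≤ N' → ∑ n ∈ Finset.Ico (N' + 1) (N + 1), |c n| ≤ ε := by
    intro ε s hs N' N hN'
    have hdis : Disjoint (Finset.Ico (N' + 1) (N + 1)) s := by
      rw [Finset.disjoint_left]
      intro n hn hns
      have h1 : N' + 1 ≤ n := (Finset.mem_Ico.1 hn).1
      have h2 : n ≤ s.sup id := Finset.le_sup (f := id) hns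
      omega
    have h := hs _ hdis
    rw [Real.norm_eq_abs, abs_of_nonneg (Finset.sum_nonneg fun n _ ↦ abs_nonneg _)] at h
    exact h.le
  -- first tail cut and the uniform negative value on `E₀ = [2, N₀]`
  obtain ⟨s₁, hs₁⟩ := summable_iff_vanishing_norm.1 hsum (δ₁ / 4) (by positivity)
  set N₀ := max n₁ (s₁.sup id) with hN₀
  have hN₀1 : 1 ≤ N₀ := le_trans (by omega) (le_max_left _ _)
  have hn₁E : n₁ ∈ Finset.Ico 2 (N₀ + 1) :=
    Finset.mem_Ico.2 ⟨hn₁, Nat.lt_succ_of_le (le_max_left _ _)⟩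
  obtain ⟨tstar, -, hPstar⟩ := exists_trigSum_le_uniform (a := c)
    (x := fun n : ℕ ↦ Real.log (n : ℝ)) hn₁E hm0 hγ0 (fun n hn ↦ hxm n (hmem hn))
    (fun n hn hne ↦ log_gap_le (hmem hn) hn₁ hne) hc₁ (hLE _)
  rw [← hC₀, ← hδ₁] at hPstar
  -- an interval around `tstar` where `P_{N₀} ≤ -(3/4)δ₁`, and a carrier off the ordinates in it
  set P₀ : ℝ → ℝ := fun t ↦ ∑ n ∈ Finset.Ico 2 (N₀ + 1), c n * Real.cos (t * Real.log (n : ℝ))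
    with hP₀
  have hcont : Continuous P₀ := by
    rw [hP₀]
    fun_prop
  obtain ⟨ε, hε, hball⟩ := Metric.continuous_iff.1 hcont tstar (δ₁ / 4) (by positivity)
  have hab : tstar - ε / 2 < tstar + ε / 2 := by linarith
  obtain ⟨t₀, ht₀, d, hd, hsep⟩ := exists_far_from_ordinates hab
  have hP₀t₀ : ∑ n ∈ Finset.Ico 2 (N₀ + 1), c n * Real.cos (t₀ * Real.log (n : ℝ)) ≤
      -(3 / 4 * δ₁) := by
    have hdist : dist t₀ tstar < ε := by
      rw [mem_Icc] at ht₀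
      rw [Real.dist_eq, abs_lt]
      constructor <;> linarith
    have h := hball t₀ hdist
    rw [Real.dist_eq, abs_lt] at h
    have h2 : P₀ t₀ < P₀ tstar + δ₁ / 4 := by linarith [h.2]
    have h3 : P₀ tstar ≤ -δ₁ := hPstar
    show P₀ t₀ ≤ _
    linarith
  -- `P_N(t₀) ≤ -δ₁/2` for every `N ≥ N₀`
  have hPN : ∀ N : ℕ, N₀ ≤ N →
      ∑ n ∈ Finset.Ico 2 (N + 1), c n * Real.cos (t₀ * Real.log (n : ℝ)) ≤ -(δ₁ / 2) := by
    intro N hN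
    have h1 := trigSum_le_add_tail c t₀ hN₀1 hN
    have h2 := htail hs₁ N₀ N (le_max_right _ _)
    linarith
  -- second tail cut, Lipschitz constant, the `O(1)` constants
  obtain ⟨s₂, hs₂⟩ := summable_iff_vanishing_norm.1 hsum (δ₁ / 32) (by positivity)
  set N₁ := max N₀ (s₂.sup id) with hN₁
  have hN₁1 : 1 ≤ N₁ := hN₀1.trans (le_max_left _ _)
  obtain ⟨K, hK⟩ := exists_plateau_lipschitz
  have hK0 : (0 : ℝ) ≤ K := K.2
  set A₁ := ∑ n ∈ Finset.Ico 2 (N₁ + 1), |c n| * Real.log (n : ℝ) with hA₁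
  have hA₁0 : 0 ≤ A₁ := Finset.sum_nonneg fun n hn ↦
    mul_nonneg (abs_nonneg _) (hm0.le.trans (hxm n (hmem hn)))
  set S := ∑' ρ : ZetaZeros.riemannZetaNontrivialZeros, weilZeroWeight (ρ : ℂ) with hSdef
  set M := (weilDecayConst plateauC * ((1 + 2 * t₀ ^ 2) * (2 + 1 / d ^ 2))) ^ 2 with hMdef
  have hS : 0 ≤ S := tsum_nonneg fun ρ ↦ weilZeroWeight_nonneg ρ.2
  have hM : 0 ≤ M := sq_nonneg _
  have hMS : 0 ≤ M * S := mul_nonneg hM hS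
  have hKA : 0 ≤ (K : ℝ) * A₁ := mul_nonneg hK0 hA₁0
  set R := max 1 ((M * S + 4 * K * A₁ + 1) / (δ₁ / 4)) with hRdef
  have hR1 : 1 ≤ R := le_max_left _ _
  have hR0 : 0 < R := by linarith
  have hRδ : M * S + 4 * K * A₁ + 1 ≤ δ₁ / 4 * R := by
    have h := le_max_right 1 ((M * S + 4 * K * A₁ + 1) / (δ₁ / 4))
    rw [← hRdef, div_le_iff₀ (by positivity)] at h
    linarith
  -- the window
  obtain ⟨N₂, hN₂⟩ := exists_window_le_log_succ_half R
  set N := max N₂ N₁ with hNdef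
  have hNN₁ : N₁ ≤ N := le_max_right _ _
  have hNN₀ : N₀ ≤ N := (le_max_left _ _).trans hNN₁
  have hN2 : 2 ≤ N := hn₁.trans ((le_max_left _ _).trans hNN₀)
  have hRN : R ≤ Real.log ((N : ℝ) + 1) / 2 := by
    refine hN₂.trans ?_
    have : (N₂ : ℝ) ≤ N := by exact_mod_cast le_max_left _ _
    gcongr
  have hg := isWeilTest_wavePacket hR0 t₀
  refine ⟨R, t₀, N, hR0, hN2, hRN, ?_⟩
  rw [multiSiteQuadratic_re, ← combShapeDetection_zeroForm_eq_weilQuadratic hg]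
  simp_rw [re_weilConv_wavePacket_overlap]
  have hZ : (zeroForm (wavePacket R t₀)).re ≤ M / R ^ 2 * S :=
    re_zeroForm_wavePacket_le hRH hR0 hd hsep
  have hZ' : M / R ^ 2 * S ≤ M * S :=
    mul_le_mul_of_nonneg_right (div_le_self hM (by nlinarith)) hS
  have hsite := siteSum_wavePacket_le (c := c) hR0 t₀ hK hN₁1 hNN₁ (by positivity : (0:ℝ) ≤ δ₁ / 2)
    (hPN N hNN₀) (htail hs₂ N₁ N (le_max_right _ _))
  rw [← hA₁] at hsite
  have e1 : -(2 * R * (δ₁ / 2)) + 4 * K * A₁ + 8 * R * (δ₁ / 32) =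
      4 * K * A₁ - 3 * (δ₁ / 4 * R) := by ring
  rw [e1] at hsite
  linarith

/-! ## §29 Tables in the `ℓ¹`-neighbourhood of `ζ`'s -/

/-- For a test function supported in the window of `N ≥ 2`, the quadratic functional of a table
`w` agreeing with `ζ`'s at `n = 0, 1` is the finitely-many-sites functional with coefficients
`c_n = Λ(n)/√n - w(n)`, sites `log n`, `2 ≤ n ≤ N`. [this work] -/
theorem tableDatum_quadratic_eq_multiSite {w : ℕ → ℝ} (h01 : ∀ n < 2, w n = zetaTable n)
    {g : ℝ → ℂ} (hg : IsWeilTest g) {N : ℕ} (hN : 2 ≤ N)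
    (hsupp : tsupport g ⊆ Icc (-(Real.log ((N : ℝ) + 1) / 2)) (Real.log ((N : ℝ) + 1) / 2)) :
    (tableDatum w).quadratic g =
      multiSiteQuadratic (Finset.Ico 2 (N + 1)) (fun n ↦ zetaTable n - w n)
        (fun n : ℕ ↦ Real.log (n : ℝ)) g := by
  rw [tableDatum_quadratic_eq_add_sum zetaTable w hg N hsupp, tableDatum_zetaTable_quadratic,
    multiSiteQuadratic, Finset.range_eq_Ico,
    ← Finset.sum_Ico_consecutive _ (show 0 ≤ 2 by omega) (show 2 ≤ N + 1 by omega)]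
  have h0 : ∑ n ∈ Finset.Ico 0 2, ((zetaTable n - w n : ℝ) : ℂ) *
      (weilConv g (weilReflect g) (Real.log n) + weilConv g (weilReflect g) (-Real.log n)) = 0 :=
    Finset.sum_eq_zero fun n hn ↦ by
      rw [h01 n (Finset.mem_Ico.1 hn).2, sub_self]
      simp
  rw [h0, zero_add]

/-- **RH branch for tables**: under RH, an `ℓ¹`-perturbed table (`≠ ζ`'s, equal to it at `0, 1`)
has a negative quadratic value on some test function. [this work] -/
theorem exists_tableDatum_quadratic_neg_of_riemannHypothesis (hRH : RiemannHypothesis)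
    {w : ℕ → ℝ} (hsum : Summable fun n ↦ |zetaTable n - w n|)
    (h01 : ∀ n < 2, w n = zetaTable n) (hne : ∃ n, w n ≠ zetaTable n) :
    ∃ g : ℝ → ℂ, IsWeilTest g ∧ ((tableDatum w).quadratic g).re < 0 := by
  obtain ⟨n₁, hn₁⟩ := hne
  have hn₁2 : 2 ≤ n₁ := by
    by_contra h
    exact hn₁ (h01 n₁ (by omega))
  obtain ⟨R, t₀, N, hR0, hN2, hRN, hneg⟩ :=
    exists_wavePacket_multiSite_neg_of_summable hRH hsum hn₁2 (sub_ne_zero.2 hn₁.symm)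
  have hg := isWeilTest_wavePacket hR0 t₀
  refine ⟨wavePacket R t₀, hg, ?_⟩
  have hsupp : tsupport (wavePacket R t₀) ⊆
      Icc (-(Real.log ((N : ℝ) + 1) / 2)) (Real.log ((N : ℝ) + 1) / 2) :=
    (tsupport_wavePacket_subset hR0 t₀).trans (Icc_subset_Icc (by linarith) hRN)
  rwa [tableDatum_quadratic_eq_multiSite h01 hg hN2 hsupp]

/-- **`¬RH` branch for tables**: under `¬RH` every `ℓ¹`-perturbed table (including `ζ`'s own) has
a negative quadratic value (sinking ground energy, part I). [this work] -/
theorem exists_tableDatum_quadratic_neg_of_not_riemannHypothesis (hRH : ¬ RiemannHypothesis)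
    {w : ℕ → ℝ} (hsum : Summable fun n ↦ |zetaTable n - w n|) :
    ∃ g : ℝ → ℂ, IsWeilTest g ∧ ((tableDatum w).quadratic g).re < 0 := by
  set L := ∑' n, |zetaTable n - w n| with hLdef
  obtain ⟨a, -, -, g, hg, hga, hnorm, hW⟩ :=
    exists_weilQuadratic_lt_of_not_riemannHypothesis hRH (2 * L) 0
  obtain ⟨N, hN⟩ := exists_window_le_log_succ_half a
  have hsupp : tsupport g ⊆ Icc (-(Real.log ((N : ℝ) + 1) / 2)) (Real.log ((N : ℝ) + 1) / 2) :=
    hga.trans (Icc_subset_Icc (by linarith) hN)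
  refine ⟨g, hg, ?_⟩
  rw [tableDatum_quadratic_eq_add_sum zetaTable w hg N hsupp, tableDatum_zetaTable_quadratic,
    Complex.add_re]
  have h := re_siteSum_le (Finset.range (N + 1)) (fun n ↦ zetaTable n - w n)
    (fun n : ℕ ↦ Real.log (n : ℝ)) hg
  simp_rw [hnorm, mul_one] at h
  have hL : ∑ n ∈ Finset.range (N + 1), 2 * |zetaTable n - w n| ≤ 2 * L := by
    rw [← Finset.mul_sum]
    exact mul_le_mul_of_nonneg_left (hsum.sum_le_tsum _ fun n _ ↦ abs_nonneg _) zero_le_two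
  have h' : (∑ n ∈ Finset.range (N + 1), ((zetaTable n - w n : ℝ) : ℂ) *
      (weilConv g (weilReflect g) (Real.log n) + weilConv g (weilReflect g) (-Real.log n))).re ≤
        ∑ n ∈ Finset.range (N + 1), 2 * |zetaTable n - w n| := h
  linarith

/-! ## §30 Main theorem: `ζ`'s table is `ℓ¹`-isolated in the positive cone -/

/-- **MAIN THEOREM (RH-free).**  Let `w : ℕ → ℝ` be a weight table with
`∑_n |Λ(n)/√n - w(n)| < ∞`, `w(0) = w(1) = 0` (`= ζ`'s entries) and `w ≠ ζ`'s table somewhere.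
Then the explicit-formula datum of `w` violates `ExplicitDatum.Positivity`: some test function
has `Re Q_w(g) < 0`. [this work] -/
theorem not_positivity_of_summable_edit {w : ℕ → ℝ} (hsum : Summable fun n ↦ |zetaTable n - w n|)
    (h01 : ∀ n < 2, w n = zetaTable n) (hne : ∃ n, w n ≠ zetaTable n) :
    ¬ (tableDatum w).Positivity := by
  intro hP
  by_cases hRH : RiemannHypothesis
  · obtain ⟨g, hg, hneg⟩ := exists_tableDatum_quadratic_neg_of_riemannHypothesis hRH hsum h01 hne
    exact absurd (hP g hg) (not_le.2 hneg)
  · obtain ⟨g, hg, hneg⟩ := exists_tableDatum_quadratic_neg_of_not_riemannHypothesis hRH hsum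
    exact absurd (hP g hg) (not_le.2 hneg)

/-- **`ℓ¹`-isolation of `ζ`'s table.**  For `w` in the `ℓ¹`-neighbourhood of `ζ`'s weight table
(and equal to it at `n = 0, 1`):
`Positivity (tableDatum w) ↔ ((∀ n, w n = Λ(n)/√n) ∧ RiemannHypothesis)`.
The only candidate for positivity is `ζ`'s own datum; whether it IS positive is RH (Weil's
criterion, imported) and is NOT claimed. [this work] -/
theorem tableDatum_positivity_iff_of_summable {w : ℕ → ℝ}
    (hsum : Summable fun n ↦ |zetaTable n - w n|) (h01 : ∀ n < 2, w n = zetaTable n) :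
    (tableDatum w).Positivity ↔ (∀ n, w n = zetaTable n) ∧ RiemannHypothesis := by
  constructor
  · intro hP
    have hw : ∀ n, w n = zetaTable n := by
      by_contra h
      push Not at h
      exact not_positivity_of_summable_edit hsum h01 h hP
    have e : w = zetaTable := funext hw
    refine ⟨hw, (siteQuadratic_zero_nonneg_iff_riemannHypothesis 1).1 fun g hg ↦ ?_⟩
    rw [siteQuadratic_zero, ← tableDatum_zetaTable_quadratic g, ← e]
    exact hP g hg
  · rintro ⟨hw, hRH⟩ g hg
    have e : w = zetaTable := funext hw
    rw [e, tableDatum_zetaTable_quadratic, ← siteQuadratic_zero 1 g]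
    exact (siteQuadratic_zero_nonneg_iff_riemannHypothesis 1).2 hRH g hg

/-- Equivalently (RH-free): a positive table in the `ℓ¹`-neighbourhood IS `ζ`'s table.
[this work] -/
theorem eq_zetaTable_of_positivity {w : ℕ → ℝ} (hsum : Summable fun n ↦ |zetaTable n - w n|)
    (h01 : ∀ n < 2, w n = zetaTable n) (hP : (tableDatum w).Positivity) : w = zetaTable :=
  funext ((tableDatum_positivity_iff_of_summable hsum h01).1 hP).1

end Summit.RiemannHypothesis.RiemannHypothesis.Theorems.PfPersistenceCoefficientRigidity

end
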